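import Summits.NavierStokesRegularity.NavierStokesRegularity.Theorems.IsobarTomographyIsobaricLinesLiouvilleHullReduction
import HarnessLib

/-!
# Shear-translation leaf for the crux `IsobaricLinesLiouville` (stmt-NavierStokesRegularity-11741), line `Ideator2Sketch`

Supports the crux (lead c2). Hull (B) of the line asks for FULL invariance of the velocity under
the translations along a fixed direction `a`. This file lands the sharper leaf that the local
analysis of the swirling axisymmetric class produces (crux dir `AxiRigidity-c2.md`, REV 4–6: the
exact z-linear family `u = h(r)`, `w = z f(r) + g(r)`, `v_θ = V(r)` has its horizontal part
invariant along the axis while `w` is affine along it): it suffices that the velocity changes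
along `a` only by multiples of `a`,
`v(t, x + δa) − v(t, x) ∈ ℝ a` for all `t < 0`, `x`, `δ`.
Incompressibility makes `δ ↦ ⟪v(t, x + δa), a⟫` affine (its slope `⟪Dv(x + δa) a, a⟫` is
independent of `δ`: the divergence of the difference field `μ • a` is `∂ₐμ`, a trace of a rank-one
map), boundedness kills the slope, so `v` is fully invariant along `a` and the landed
`2½`-dimensional Liouville theorem `sliceConst_of_translationInvariant` applies.
Sources: Koch–Nadirashvili–Seregin–Šverák 2009 (arXiv:0709.3599) Thm 5.1 (through the imported
leaf); the rank-one trace identity is folklore.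
-/

noncomputable section

-- the summit and its single problem share the name (D-0017 nested layout)
set_option linter.dupNamespace false

namespace Summit.NavierStokesRegularity.NavierStokesRegularity.Theorems.IsobaricLinesLiouville.FluxSurfacePersistence

open scoped InnerProductSpace RealInnerProductSpace Topology ContDiff
open Literature.Analysis.FluidPDE Set Function

/-- **Rank-one shear of a divergence-free field is slope-free.** If `v` and `v + μ • a` are both
divergence free and differentiable, then `∂ₐ μ ≡ 0`: the divergence of `y ↦ μ(y) • a` is the trace
of the rank-one map `(Dμ) ⊗ a`, i.e. `Dμ(a)`. [folklore] -/
theorem fderiv_apply_eq_zero_of_isDivFree_add_smul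
    {v : EuclideanSpace ℝ (Fin 3) → EuclideanSpace ℝ (Fin 3)} {μ : EuclideanSpace ℝ (Fin 3) → ℝ}
    (a : EuclideanSpace ℝ (Fin 3)) (hv : Differentiable ℝ v) (hμ : Differentiable ℝ μ)
    (hdiv : VectorCalculus.IsDivFree v) (hdiv' : VectorCalculus.IsDivFree fun y => v y + μ y • a)
    (x : EuclideanSpace ℝ (Fin 3)) : fderiv ℝ μ x a = 0 := by
  have h1 := hdiv' x
  have h0 := hdiv x
  unfold VectorCalculus.divergence at h1 h0
  rw [fderiv_fun_add (hv x) ((hμ x).smul_const a), fderiv_smul_const (hμ x) a] at h1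
  rw [show ((fderiv ℝ v x + (fderiv ℝ μ x).smulRight a :
          EuclideanSpace ℝ (Fin 3) →L[ℝ] EuclideanSpace ℝ (Fin 3)) :
          EuclideanSpace ℝ (Fin 3) →ₗ[ℝ] EuclideanSpace ℝ (Fin 3)) =
      (fderiv ℝ v x : EuclideanSpace ℝ (Fin 3) →ₗ[ℝ] EuclideanSpace ℝ (Fin 3)) +
        ((fderiv ℝ μ x : EuclideanSpace ℝ (Fin 3) →L[ℝ] ℝ) :
          EuclideanSpace ℝ (Fin 3) →ₗ[ℝ] ℝ).smulRight a from rfl,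
    map_add, h0, zero_add, LinearMap.trace_smulRight] at h1
  exact h1

/-- **A bounded function on `ℝ` with constant derivative is constant** (the slope must vanish).
[folklore] -/
theorem eq_of_hasDerivAt_const_of_bounded {φ : ℝ → ℝ} {c M : ℝ}
    (hφ : ∀ s, HasDerivAt φ c s) (hM : ∀ s, |φ s| ≤ M) (s : ℝ) : φ s = φ 0 := by
  -- `φ s = φ 0 + c s`
  have haff : ∀ s, φ s - c * s = φ 0 := by
    intro s
    have hψ : ∀ r, HasDerivAt (fun r => φ r - c * r) 0 r := fun r => by
      simpa using (hφ r).fun_sub ((hasDerivAt_id r).const_mul c)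
    have h := is_const_of_deriv_eq_zero (f := fun r => φ r - c * r)
      (fun r => (hψ r).differentiableAt) (fun r => (hψ r).deriv) s 0
    simpa using h
  have hM0 : 0 ≤ M := (abs_nonneg _).trans (hM 0)
  have key : ∀ s, |c * s| ≤ 2 * M := by
    intro s
    have hcs : c * s = φ s - φ 0 := by linarith [haff s]
    rw [hcs]
    calc |φ s - φ 0| ≤ |φ s| + |φ 0| := abs_sub _ _
      _ ≤ M + M := add_le_add (hM _) (hM _)
      _ = 2 * M := by ring
  -- the slope vanishes
  have hc : c = 0 := by
    by_contra hc
    have h1 := key ((2 * M + 1) / c)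
    rw [mul_div_cancel₀ _ hc] at h1
    linarith [le_abs_self (2 * M + 1)]
  have := haff s
  rw [hc, zero_mul, sub_zero] at this
  exact this

/-- **Shear-translation leaf** (sharpening of hull (B), LEAF of the conjectured local normal form of
the swirling axisymmetric isobaric class): a bounded ancient mild solution (`ν = 1`), classical on
`(-∞,0)`, whose velocity changes along a fixed `a ≠ 0` only by multiples of `a` at every `t < 0`
(`v(t, x + δa) − v(t, x) = μ • a`) is constant on every slice. Incompressibility makes
`δ ↦ ⟪v(t, x + δa), a⟫` affine, boundedness makes it constant, so `v(t, ·)` is invariant along `a`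
and `sliceConst_of_translationInvariant` (KNSS 2009 Thm 5.1 via the landed `e₁`-leaf) concludes. -/
theorem sliceConst_of_shearTranslation
    (v : ℝ → (EuclideanSpace ℝ (Fin 3)) → (EuclideanSpace ℝ (Fin 3)))
    (q : ℝ → (EuclideanSpace ℝ (Fin 3)) → ℝ)
    (hanc : IsBoundedAncientMildSolution 1 v) (hcl : IsClassicalNSSolutionOn (Set.Iio 0) 1 0 v q)
    (a : EuclideanSpace ℝ (Fin 3)) (ha : a ≠ 0)
    (hshear : ∀ t < 0, ∀ (x : EuclideanSpace ℝ (Fin 3)) (δ : ℝ), ∃ μ : ℝ,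
      v t (x + δ • a) - v t x = μ • a) :
    ∀ t < 0, ∃ b : EuclideanSpace ℝ (Fin 3), v t = fun _ => b := by
  refine sliceConst_of_translationInvariant v q hanc hcl a ha fun t ht x δ => ?_
  obtain ⟨C, hC⟩ := hanc.isBoundedOn
  have hVd : Differentiable ℝ (v t) := (hcl.contDiff_velocity ht).differentiable (by simp)
  have hdiv : VectorCalculus.IsDivFree (v t) := hcl.divFree t ht
  have ha2 : (0 : ℝ) < ‖a‖ ^ 2 := by positivity
  -- the shear coefficient as a function of the base point, for a fixed step `δ'`
  set μf : ℝ → EuclideanSpace ℝ (Fin 3) → ℝ := fun δ' y => ⟪v t (y + δ' • a) - v t y, a⟫ / ‖a‖ ^ 2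
    with hμf
  have hμ_eq : ∀ δ' y, v t (y + δ' • a) - v t y = μf δ' y • a := by
    intro δ' y
    obtain ⟨μ, hμ⟩ := hshear t ht y δ'
    have : μf δ' y = μ := by
      simp only [hμf, hμ, real_inner_smul_left, real_inner_self_eq_norm_sq]
      rw [mul_div_assoc, div_self ha2.ne', mul_one]
    rw [this, hμ]
  have hshift : ∀ δ', Differentiable ℝ fun y => v t (y + δ' • a) := fun δ' y =>
    (hVd (y + δ' • a)).comp y ((differentiableAt_id (𝕜 := ℝ)).add_const ((δ' : ℝ) • a))
  have hμd : ∀ δ', Differentiable ℝ (μf δ') := by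
    intro δ'
    have h1 : Differentiable ℝ fun y => v t (y + δ' • a) - v t y := (hshift δ').sub hVd
    have h2 : Differentiable ℝ fun y => ⟪v t (y + δ' • a) - v t y, a⟫ := h1.inner ℝ (differentiable_const a)
    show Differentiable ℝ fun y => ⟪v t (y + δ' • a) - v t y, a⟫ / ‖a‖ ^ 2
    simp_rw [div_eq_mul_inv]
    exact h2.mul_const _
  -- the translate is divergence free, and equals `v + μ • a`
  have hdiv' : ∀ δ', VectorCalculus.IsDivFree fun y => v t y + μf δ' y • a := by
    intro δ' y
    have hfun : (fun y => v t y + μf δ' y • a) = fun y => v t (y + δ' • a) := by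
      funext y; rw [← hμ_eq δ' y]; abel
    rw [hfun]
    have := hdiv (y + δ' • a)
    unfold VectorCalculus.divergence at this ⊢
    rwa [fderiv_comp_add_right]
  have hslope : ∀ δ' y, fderiv ℝ (μf δ') y a = 0 := fun δ' y =>
    fderiv_apply_eq_zero_of_isDivFree_add_smul a hVd (hμd δ') hdiv (hdiv' δ') y
  -- `φ(s) = ⟪v(x + s a), a⟫` has constant derivative `c = ⟪Dv(x) a, a⟫`
  set φ : ℝ → ℝ := fun s => ⟪v t (x + s • a), a⟫ with hφ
  set c : ℝ := ⟪fderiv ℝ (v t) x a, a⟫ with hc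
  have hline : ∀ s, HasDerivAt (fun s : ℝ => x + s • a) a s := fun s => by
    simpa using ((hasDerivAt_id s).smul_const a).const_add x
  have hφ' : ∀ s, HasDerivAt φ ⟪fderiv ℝ (v t) (x + s • a) a, a⟫ s := by
    intro s
    have h1 : HasDerivAt (fun s : ℝ => v t (x + s • a)) (fderiv ℝ (v t) (x + s • a) a) s :=
      ((hVd (x + s • a)).hasFDerivAt.comp_hasDerivAt s (hline s))
    simpa [hφ] using h1.inner ℝ (hasDerivAt_const s a)
  -- the derivative is independent of `s`: differentiate `v(y + s a) = v(y) + μ_s(y) a` at `y = x` along `a`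
  have hconst : ∀ s : ℝ, ⟪fderiv ℝ (v t) (x + s • a) a, a⟫ = c := by
    intro s
    have hfun : (fun y => v t (y + s • a)) = fun y => v t y + μf s y • a := by
      funext y; rw [← hμ_eq s y]; abel
    have h1 : fderiv ℝ (fun y => v t (y + s • a)) x = fderiv ℝ (v t) (x + s • a) := by
      rw [fderiv_comp_add_right]
    have h2 : fderiv ℝ (fun y => v t (y + s • a)) x a = fderiv ℝ (v t) x a + fderiv ℝ (μf s) x a • a := by
      rw [hfun, fderiv_fun_add (hVd x) ((hμd s x).smul_const a), fderiv_smul_const (hμd s x) a]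
      simp
    rw [← h1, h2, hslope s x, zero_smul, add_zero]
  have hφc : ∀ s, HasDerivAt φ c s := fun s => hconst s ▸ hφ' s
  -- `φ` is bounded, hence constant
  have hφb : ∀ s, |φ s| ≤ C * ‖a‖ := fun s =>
    (abs_real_inner_le_norm _ _).trans (mul_le_mul_of_nonneg_right (hC t ht _) (norm_nonneg _))
  have hφδ : φ δ = φ 0 := eq_of_hasDerivAt_const_of_bounded hφc hφb δ
  -- conclude: the shear coefficient at `(x, δ)` vanishes
  have hμ0 : μf δ x = 0 := by
    rw [hμf]; dsimp only
    rw [inner_sub_left]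
    have : ⟪v t (x + δ • a), a⟫ = ⟪v t (x + (0 : ℝ) • a), a⟫ := hφδ
    rw [this]; simp
  have := hμ_eq δ x
  rw [hμ0, zero_smul, sub_eq_zero] at this
  exact this

/-- Registered leaf stub of line `Ideator2Sketch` (`ledger workitem stub-add stmt-NavierStokesRegularity-11741
--name stub_shearTranslationLeaf`): the shear-translation leaf, verbatim `sliceConst_of_shearTranslation`. -/
theorem stub_shearTranslationLeaf :
    ∀ (v : ℝ → EuclideanSpace ℝ (Fin 3) → EuclideanSpace ℝ (Fin 3)) (q : ℝ → EuclideanSpace ℝ (Fin 3) → ℝ),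
      Literature.Analysis.FluidPDE.IsBoundedAncientMildSolution 1 v →
        Literature.Analysis.FluidPDE.IsClassicalNSSolutionOn (Set.Iio 0) 1 0 v q →
          ∀ (a : EuclideanSpace ℝ (Fin 3)), a ≠ 0 →
            (∀ t < 0, ∀ (x : EuclideanSpace ℝ (Fin 3)) (δ : ℝ), ∃ μ : ℝ, v t (x + δ • a) - v t x = μ • a) →
              ∀ t < 0, ∃ b : EuclideanSpace ℝ (Fin 3), v t = fun _ => b :=
  sliceConst_of_shearTranslation

end Summit.NavierStokesRegularity.NavierStokesRegularity.Theorems.IsobaricLinesLiouville.FluxSurfacePersistence
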